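import Summits.CriticalPhenomena.PercolationContinuityZ3.Theorems.PercNearOneGluingNoHeavyLowerTailAntitheticPositivePart
import HarnessLib

/-!
# `NoHeavyLowerTail` (stmt-CriticalPhenomena-4575) — antithetic cluster pairs: **CONJECTURE U♯ for shift pairs with antitone gap** — the
# `F⁺`-anchored double-set diagonal (prim-hp-2 gen 74, HOME/THEOREM-W.md §3, HOME/MEMO-gen74.md §0(3))

Support file (`--supports stmt-CriticalPhenomena-4575`, hull-port prover `prim-hp-2`, gen 74).  No definitions, no named facts, no sorries;
standard axioms.  Notation of …AntitheticPositivePart: `X T = openCluster (T ∩ E) s`, `Y T = openCluster (Tᶜ ∩ E) s`, double set `X T ∩ Y T`.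

CONJECTURE U♯ (HOME/THEOREM-W.md §3): for every increasing event `𝒰` and all monotone `F⁻ ≤ F⁺`, `G⁻ ≤ G⁺`,
   `0 ≤ Σ_{T ∈ 𝒰} [ (F⁺X − F⁻Y)(G⁺X − G⁻Y) + (F⁺X − F⁺(X∩Y))(G⁺X − G⁺(X∩Y)) ]`
(THEOREM U of gen 73 with the anchor `{s}` replaced by the double set; 0 negatives in 6 826 ⊕/TOP-negative fan-calculus records and 29 258 small /
random (graph, up-set) pairs).  THEOREM (`Antithetic.PosPart.upset_double_diag_sum_nonneg_of_antitone_gap`): it HOLDS whenever the gaps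
`F⁺ − F⁻` and `G⁺ − G⁻` are ANTITONE set functions (constant shifts, the odd class `F⁻ = F⁺`, `F⁻ = F⁺ − c·𝟙[· ∌ v]`, …); the lower functions need
not even be monotone.  PROOF: `F⁺X − F⁻Y = (F⁺X − F⁺Y) + δ_F(Y)` with `δ_F = F⁺ − F⁻ ≥ 0`; the odd part carries the double-set diagonal
(`PosPart.upset_double_diag_sum_nonneg`, THEOREM W); the mixed terms `Σ_𝒰 δ_G(Y)·(F⁺X − F⁺Y)`, `Σ_𝒰 δ_F(Y)·(G⁺X − G⁺Y)` are instances of the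
MASTER LEMMA `PosPart.cluster_weighted_sum_nonneg` because `δ_G ∘ Y` is a nonnegative INCREASING weight when the gap is antitone; `δ_F δ_G ≥ 0`.
For general shift pairs (extreme rays `(𝟙_{𝒜⁻}, 𝟙_{𝒜⁺})`, gap `𝟙[𝒜⁺ ∖ 𝒜⁻]` not monotone) the conjecture stays open.
[cite: VandenbergHaggstromKahn2005, §1 p. 6 ("Harris' inequality"), §1 p. 3 (open cluster `C_s`)]
-/

noncomputable section

namespace Summit.CriticalPhenomena.PercolationContinuityZ3.Theorems

open Literature.Probability.Percolation
open scoped Classical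

namespace Antithetic

namespace PosPart

variable {V : Type*} [Fintype V]

/-- **CONJECTURE U♯ for shift pairs with ANTITONE GAP.**  For every finite edge set `E`, source `s`, increasing event `𝒰`, monotone `F⁺, G⁺` and
lower functions `F⁻ ≤ F⁺`, `G⁻ ≤ G⁺` whose GAPS `F⁺ − F⁻`, `G⁺ − G⁻` are antitone (e.g. constant shifts, the odd class):
`0 ≤ Σ_{T ∈ 𝒰} [ (F⁺(X T) − F⁻(Y T))(G⁺(X T) − G⁻(Y T)) + (F⁺(X T) − F⁺(X T ∩ Y T))(G⁺(X T) − G⁺(X T ∩ Y T)) ]`. [this work] -/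
theorem upset_double_diag_sum_nonneg_of_antitone_gap (E : Set (Sym2 V)) (s : V) (U : Set (Sym2 V) → Prop) [DecidablePred U]
    (hU : ∀ ⦃T T' : Set (Sym2 V)⦄, T ⊆ T' → U T → U T')
    (Fp Fm Gp Gm : Set V → ℝ) (hFp : Monotone Fp) (hGp : Monotone Gp) (hF : ∀ S, Fm S ≤ Fp S) (hG : ∀ S, Gm S ≤ Gp S)
    (hFgap : Antitone fun S => Fp S - Fm S) (hGgap : Antitone fun S => Gp S - Gm S) :
    0 ≤ ∑ T ∈ Finset.univ.filter U,
      ((Fp (openCluster (T ∩ E) s) - Fm (openCluster (Tᶜ ∩ E) s)) * (Gp (openCluster (T ∩ E) s) - Gm (openCluster (Tᶜ ∩ E) s)) +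
        (Fp (openCluster (T ∩ E) s) - Fp (openCluster (T ∩ E) s ∩ openCluster (Tᶜ ∩ E) s)) *
          (Gp (openCluster (T ∩ E) s) - Gp (openCluster (T ∩ E) s ∩ openCluster (Tᶜ ∩ E) s))) := by
  -- notation
  let X : Set (Sym2 V) → Set V := fun T => openCluster (T ∩ E) s
  let Y : Set (Sym2 V) → Set V := fun T => openCluster (Tᶜ ∩ E) s
  have hYanti : Antitone Y := fun T T' h => Freeze.openCluster_mono (Set.inter_subset_inter_left E (Set.compl_subset_compl.2 h)) s
  let u : Set (Sym2 V) → ℝ := fun T => if U T then 1 else 0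
  have hu0 : ∀ T, 0 ≤ u T := fun T => by simp only [u]; split_ifs <;> norm_num
  have hu : Monotone u := by
    intro T T' h
    simp only [u]
    by_cases hT : U T
    · rw [if_pos hT, if_pos (hU h hT)]
    · rw [if_neg hT]; split_ifs <;> norm_num
  let dF : Set (Sym2 V) → ℝ := fun T => Fp (Y T) - Fm (Y T)
  let dG : Set (Sym2 V) → ℝ := fun T => Gp (Y T) - Gm (Y T)
  have hdF0 : ∀ T, 0 ≤ dF T := fun T => sub_nonneg.2 (hF _)
  have hdG0 : ∀ T, 0 ≤ dG T := fun T => sub_nonneg.2 (hG _)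
  have hdFmono : Monotone dF := fun T T' h => hFgap (hYanti h)
  have hdGmono : Monotone dG := fun T T' h => hGgap (hYanti h)
  -- (1) the odd part with the double-set diagonal (THEOREM W)
  have h1 := upset_double_diag_sum_nonneg E s U hU Fp Gp hFp hGp
  rw [Finset.sum_filter] at h1
  -- (2) the mixed terms are master-lemma instances
  have hKF : ∀ ⦃P P' Q Q' : Set V⦄, P ⊆ P' → Q' ⊆ Q → Fp P - Fp Q ≤ Fp P' - Fp Q' := fun P P' Q Q' h1 h2 => sub_le_sub (hFp h1) (hFp h2)
  have hKG : ∀ ⦃P P' Q Q' : Set V⦄, P ⊆ P' → Q' ⊆ Q → Gp P - Gp Q ≤ Gp P' - Gp Q' := fun P P' Q Q' h1 h2 => sub_le_sub (hGp h1) (hGp h2)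
  have hsoF : ∀ P Q : Set V, 0 ≤ Fp P - Fp Q + (Fp Q - Fp P) := fun P Q => by linarith
  have hsoG : ∀ P Q : Set V, 0 ≤ Gp P - Gp Q + (Gp Q - Gp P) := fun P Q => by linarith
  have hw2 : Monotone fun T => u T * dG T := fun T T' h => mul_le_mul (hu h) (hdGmono h) (hdG0 T) (hu0 T')
  have hw3 : Monotone fun T => u T * dF T := fun T T' h => mul_le_mul (hu h) (hdFmono h) (hdF0 T) (hu0 T')
  have h2 := cluster_weighted_sum_nonneg E s hKF hsoF (w := fun T => u T * dG T) (fun T => mul_nonneg (hu0 T) (hdG0 T)) hw2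
  have h3 := cluster_weighted_sum_nonneg E s hKG hsoG (w := fun T => u T * dF T) (fun T => mul_nonneg (hu0 T) (hdF0 T)) hw3
  -- (3) the gap product is nonnegative
  have h4 : 0 ≤ ∑ T : Set (Sym2 V), u T * (dF T * dG T) :=
    Finset.sum_nonneg fun T _ => mul_nonneg (hu0 T) (mul_nonneg (hdF0 T) (hdG0 T))
  -- (4) pointwise identity
  rw [Finset.sum_filter]
  have hsum : ∑ T : Set (Sym2 V), (if U T then
      (Fp (X T) - Fm (Y T)) * (Gp (X T) - Gm (Y T)) + (Fp (X T) - Fp (X T ∩ Y T)) * (Gp (X T) - Gp (X T ∩ Y T)) else 0) =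
    ∑ T : Set (Sym2 V), (if U T then
      (Fp (X T) - Fp (Y T)) * (Gp (X T) - Gp (Y T)) + (Fp (X T) - Fp (X T ∩ Y T)) * (Gp (X T) - Gp (X T ∩ Y T)) else 0) +
    ∑ T : Set (Sym2 V), (u T * dG T) * (Fp (X T) - Fp (Y T)) +
    ∑ T : Set (Sym2 V), (u T * dF T) * (Gp (X T) - Gp (Y T)) +
    ∑ T : Set (Sym2 V), u T * (dF T * dG T) := by
    rw [← Finset.sum_add_distrib, ← Finset.sum_add_distrib, ← Finset.sum_add_distrib]
    refine Finset.sum_congr rfl fun T _ => ?_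
    simp only [u, dF, dG]
    split_ifs
    · ring
    · ring
  rw [hsum]
  linarith

end PosPart

end Antithetic

end Summit.CriticalPhenomena.PercolationContinuityZ3.Theorems
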